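/-
Copyright (c) 2026 the pub-hodgecm-mathlib formalisation cell (harness21).  Prover seat hodgecm-mathlib-K2E3-p12 (g3), Track B «K2-LIT» ∕ h413
(`stmt-HodgeConjecture-24833`), line `K2_E3_EllipticInputs`, unit U12-d, §L at `N = 2`: THE REGULAR NILPOTENT ORBITAL MEASURE
`μ_reg(f) = ∫_{GL₂(𝒪) × F} f(k (tE₁₂) k⁻¹)` ON `𝔤𝔩₂(F)` IS AN ELEMENT OF `J(𝒩)` (invariant distribution supported in the nilpotent cone) WHICH IS NOT A
MULTIPLE OF `δ₀`.  2026-09-04.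
-/
import Summits.HodgeConjecture.HodgeConjecture.Theorems.K2E3GL2UnipotentAverageConjInvariant   -- ★ p856694 (this seat): `GL2.unipotentAverage_comp_conj_eq`
import Literature.NumberTheory.Automorphic.LocalFieldHaarBalls                               -- ★ `normAbs` kit, `primePowBall`
import Literature.NumberTheory.Rogawski1990.LocalTransferGlue                               -- ★ `IsLocSmooth.indicator`, `tsupport_indicator_subset_of_isClosed`
import HarnessLib

/-!
# K2_E3 road (h413), §L at `N = 2` — the regular nilpotent orbital measure on `𝔤𝔩₂(F)` lies in `J(𝒩)` and is not point-supported

Cell `pub/hodgecm-mathlib` (D-0151), Track B (21-frontier RULING «PUSH BOTH» 2026-09-03, director req624), seat K2E3-p12 (g3), §L line lead; dealer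
K2E3-plan (g2) deal (D20) (γ).  `--supports stmt-HodgeConjecture-24833 --as helper`; THEOREMS ONLY (no definition ∕ instance ∕ notation ∕ named fact ∕
`sorry`); never imports `Cruxes/…/Lines`.

(L-B_GL) at `N = 2` (`sig_K2E3GLnNilpotentFourierRegular` of U12 ED. 7, §L) is Harish-Chandra's Thm. 4.4 for the TWO-DIMENSIONAL space `J(𝒩) = ℂ δ₀ ⊕ ℂ μ_reg` of
invariant distributions on `𝔤𝔩₂(F)` supported in the nilpotent cone [HarishChandra1999, Thm. 3.9∕Cor. 3.10 (dim `J(𝒩)` = number of nilpotent orbits), §3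
(Deligne–Rao)].  The `δ₀`-summand is ★ p856457; this file supplies the SECOND GENERATOR in the socket's own currency — the functional
`T(f) = ∫_{K × F} f(k (t E₁₂) k⁻¹) d(κ ⊗ dt)` (`K = GL₂(𝒪)`, `E₁₂ = [[0,1],[0,0]]`; Rao's `K × N`-form of the invariant measure of the regular nilpotent orbit):
* §1 `conj_nilp_eq`, `isNilpotent_conj_nilp`, `continuous_conjNilp` — the orbit map `(k, t) ↦ k (tE₁₂) k⁻¹`; `integrable_comp_conjNilp` — `f ∘` orbit map
  is integrable on `K × F` for `f ∈ C_c^∞(𝔤𝔩₂(F))` (continuous with compact support: `t` is read off the compact set `K⁻¹ (supp f) K`).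
* §2 the four `J(𝒩)` clauses: **`nilpotentAverage_add`**, **`nilpotentAverage_smul`**, **`nilpotentAverage_eq_zero_of_forall_not_isNilpotent`** and
  **`nilpotentAverage_conj`** — `GL₂(F)`-INVARIANCE, from ★ `GL2.unipotentAverage_comp_conj_eq` (the group-side regular unipotent average is conjugation
  invariant) through the Cayley-free dictionary `k n(t) k⁻¹ − 1 = k (tE₁₂) k⁻¹` and the `Ad`-invariant clopen cut-off `{|det X| < 1, |tr X| < 1} ⊇ 𝒩`
  (which makes `g ↦ f(g − 1)` compactly supported on `GL₂(F)`: `isCompact_preimage_val_of_det`).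
* §3 **`nilpotentAverage_indicator_ne_zero`** — `T(1_U) ≠ 0` for the compact open box `U = E₁₂ + (𝔭)^{2×2} ∌ 0`: `T ∉ ℂ δ₀`.
[HarishChandra1999AdmissibleDistributions, §3 pp. 8–10, Thm. 3.9, Cor. 3.10, Thm. 4.4] [Rogawski1990, §8.1 p. 112].
HONEST LABEL: HC_CM is proved only modulo the 7 printed citations (2 remaining named inputs: hLiu418 = stmt-HodgeConjecture-24832, h413 =
stmt-HodgeConjecture-24833) until rung 0 closes; count-neutral helper — (L-B_GL) at `N = 2` still owes `J(𝒩) ⊆ ℂδ₀ + ℂμ_reg` and the explicit `μ̂_reg`.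

References: [HarishChandra1999AdmissibleDistributions] Harish-Chandra (DeBacker–Sally), *Admissible Invariant Distributions on Reductive p-adic Groups* (1999),
§3, Thm. 3.9, Cor. 3.10, Thm. 4.4 · [Rogawski1990] J. D. Rogawski, *Automorphic Representations of Unitary Groups in Three Variables* (1990), §8.1 p. 112.
-/

set_option autoImplicit false
set_option linter.dupNamespace false   -- `Summit.HodgeConjecture.HodgeConjecture.…` (D-0017 nested layout; lakefile exemption for Summits)

noncomputable section

open MeasureTheory Measure Filter Topology
open scoped MatrixGroups NNReal ENNReal
open Literature.NumberTheory.Rogawski1990 Literature.NumberTheory.Automorphic Literature.NumberTheory.Automorphic.LocalFieldHaar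
open Literature.NumberTheory.GaloisRepresentations Literature.NumberTheory.GaloisRepresentations.IsNonarchimedeanLocalField
open Summit.HodgeConjecture.HodgeConjecture.Cruxes.H413.K2E3GL2UnipotentAverageConjInvariant

namespace Summit.HodgeConjecture.HodgeConjecture.Cruxes.H413.K2E3GL2RegularNilpotentOrbitalMeasure

variable {F : Type*} [Field F] [ValuativeRel F] [TopologicalSpace F] [IsNonarchimedeanLocalField F]

/-! ## §1  The orbit map `(k, t) ↦ k (tE₁₂) k⁻¹` -/
omit [ValuativeRel F] [TopologicalSpace F] [IsNonarchimedeanLocalField F] in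
/-- `k n(t) k⁻¹ − 1 = k (tE₁₂) k⁻¹` (`n(t) = 1 + tE₁₂`). [cite: Rogawski1990, §8.1 p. 112] -/
theorem conj_unipotentGL2_sub_one (k : GL (Fin 2) F) (t : F) :
    ((k * ((unipotentGL2 t : ↥(upperUnitriangular (Fin 2) F)) : GL (Fin 2) F) * k⁻¹ : GL (Fin 2) F) : Matrix (Fin 2) (Fin 2) F) - 1 =
      (k : Matrix (Fin 2) (Fin 2) F) * !![0, t; 0, 0] * ((k⁻¹ : GL (Fin 2) F) : Matrix (Fin 2) (Fin 2) F) := by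
  have hn : (((unipotentGL2 t : ↥(upperUnitriangular (Fin 2) F)) : GL (Fin 2) F) : Matrix (Fin 2) (Fin 2) F) = 1 + !![0, t; 0, 0] := by
    rw [coe_unipotentGL2]
    ext i j
    fin_cases i <;> fin_cases j <;> simp
  have hkk : (k : Matrix (Fin 2) (Fin 2) F) * ((k⁻¹ : GL (Fin 2) F) : Matrix (Fin 2) (Fin 2) F) = 1 := by
    rw [← Units.val_mul, mul_inv_cancel, Units.val_one]
  rw [Units.val_mul, Units.val_mul, hn, Matrix.mul_add, Matrix.mul_one, Matrix.add_mul, hkk, add_sub_cancel_left]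

omit [ValuativeRel F] [TopologicalSpace F] [IsNonarchimedeanLocalField F] in
/-- `k (tE₁₂) k⁻¹` is nilpotent (square zero). [cite: HarishChandra1999AdmissibleDistributions, §3 p. 8] -/
theorem isNilpotent_conj_nilp (k : GL (Fin 2) F) (t : F) :
    IsNilpotent ((k : Matrix (Fin 2) (Fin 2) F) * !![0, t; 0, 0] * ((k⁻¹ : GL (Fin 2) F) : Matrix (Fin 2) (Fin 2) F)) := by
  refine ⟨2, ?_⟩
  have hE : (!![0, t; 0, 0] : Matrix (Fin 2) (Fin 2) F) * !![0, t; 0, 0] = 0 := by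
    ext i j; fin_cases i <;> fin_cases j <;> simp [Matrix.mul_apply, Fin.sum_univ_two]
  have hkk : ((k⁻¹ : GL (Fin 2) F) : Matrix (Fin 2) (Fin 2) F) * (k : Matrix (Fin 2) (Fin 2) F) = 1 := by
    rw [← Units.val_mul, inv_mul_cancel, Units.val_one]
  rw [pow_two, Matrix.mul_assoc, Matrix.mul_assoc, ← Matrix.mul_assoc ((k⁻¹ : GL (Fin 2) F) : Matrix (Fin 2) (Fin 2) F) _, ← Matrix.mul_assoc ((k⁻¹ : GL (Fin 2) F) : Matrix (Fin 2) (Fin 2) F),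
    hkk, Matrix.one_mul, ← Matrix.mul_assoc (!![0, t; 0, 0]), hE, Matrix.zero_mul, Matrix.mul_zero]

/-- The orbit map `(k, t) ↦ k (tE₁₂) k⁻¹ : GL₂(𝒪) × F → 𝔤𝔩₂(F)` is continuous. [folklore] -/
theorem continuous_conjNilp :
    Continuous fun p : ↥(glInt 2 F) × F =>
      ((p.1 : GL (Fin 2) F) : Matrix (Fin 2) (Fin 2) F) * !![0, p.2; 0, 0] * ((((p.1 : GL (Fin 2) F))⁻¹ : GL (Fin 2) F) : Matrix (Fin 2) (Fin 2) F) := by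
  have h1 : Continuous fun p : ↥(glInt 2 F) × F => ((p.1 : GL (Fin 2) F) : Matrix (Fin 2) (Fin 2) F) :=
    Units.continuous_val.comp (continuous_subtype_val.comp continuous_fst)
  have h2 : Continuous fun p : ↥(glInt 2 F) × F => (!![0, p.2; 0, 0] : Matrix (Fin 2) (Fin 2) F) := by
    refine continuous_matrix fun i j => ?_
    fin_cases i <;> fin_cases j
    · simp only [Matrix.of_apply, Matrix.cons_val', Matrix.cons_val_fin_one]; exact continuous_const
    · simp only [Matrix.of_apply, Matrix.cons_val', Matrix.cons_val_fin_one]; exact continuous_snd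
    · simp only [Matrix.of_apply, Matrix.cons_val', Matrix.cons_val_fin_one]; exact continuous_const
    · simp only [Matrix.of_apply, Matrix.cons_val', Matrix.cons_val_fin_one]; exact continuous_const
  have h3 : Continuous fun p : ↥(glInt 2 F) × F => ((((p.1 : GL (Fin 2) F))⁻¹ : GL (Fin 2) F) : Matrix (Fin 2) (Fin 2) F) :=
    Units.continuous_coe_inv.comp (continuous_subtype_val.comp continuous_fst)
  exact (h1.mul h2).mul h3

omit [ValuativeRel F] [TopologicalSpace F] [IsNonarchimedeanLocalField F] in
/-- `tE₁₂ = k⁻¹ (k (tE₁₂) k⁻¹) k`: the parameter `t` is read off the conjugate (as its `(0,1)` entry after conjugating back). [folklore] -/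
theorem nilp_eq_inv_conj_conj (k : GL (Fin 2) F) (t : F) :
    (!![0, t; 0, 0] : Matrix (Fin 2) (Fin 2) F) =
      ((k⁻¹ : GL (Fin 2) F) : Matrix (Fin 2) (Fin 2) F) * ((k : Matrix (Fin 2) (Fin 2) F) * !![0, t; 0, 0] * ((k⁻¹ : GL (Fin 2) F) : Matrix (Fin 2) (Fin 2) F)) *
        (k : Matrix (Fin 2) (Fin 2) F) := by
  have h1 : ((k⁻¹ : GL (Fin 2) F) : Matrix (Fin 2) (Fin 2) F) * (k : Matrix (Fin 2) (Fin 2) F) = 1 := by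
    rw [← Units.val_mul, inv_mul_cancel, Units.val_one]
  rw [Matrix.mul_assoc, Matrix.mul_assoc, h1, Matrix.mul_one, ← Matrix.mul_assoc, h1, Matrix.one_mul]

section Integrable
variable [MeasurableSpace F] [BorelSpace F] [MeasurableSpace (GL (Fin 2) F)] [BorelSpace (GL (Fin 2) F)]
  (κ : Measure ↥(glInt 2 F)) [IsFiniteMeasureOnCompacts κ] (dx : Measure F) [IsFiniteMeasureOnCompacts dx]

/-- **`(k, t) ↦ f(k (tE₁₂) k⁻¹)` is continuous with compact support, hence integrable on `GL₂(𝒪) × F`**, for `f ∈ C_c^∞(𝔤𝔩₂(F))`: `t` ranges in the compact set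
`{(k⁻¹ X k)₀₁ : k ∈ GL₂(𝒪), X ∈ supp f}`. [cite: HarishChandra1999AdmissibleDistributions, §3 p. 9] -/
theorem integrable_comp_conjNilp {f : Matrix (Fin 2) (Fin 2) F → ℂ} (hf : IsLocSmooth f) :
    Integrable (fun p : ↥(glInt 2 F) × F =>
      f (((p.1 : GL (Fin 2) F) : Matrix (Fin 2) (Fin 2) F) * !![0, p.2; 0, 0] * ((((p.1 : GL (Fin 2) F))⁻¹ : GL (Fin 2) F) : Matrix (Fin 2) (Fin 2) F)))
      (κ.prod dx) := by
  haveI : CompactSpace ↥(glInt 2 F) := isCompact_iff_compactSpace.1 (isCompact_glInt 2 F)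
  haveI : T2Space F := (isLocalField F).toT2Space
  haveI : SecondCountableTopology F := secondCountableTopology_localField F
  haveI : BorelSpace ↥(glInt 2 F) := Subtype.borelSpace _
  have hcont := hf.continuous.comp (continuous_conjNilp (F := F))
  -- the compact set of parameters `t`
  set C' : Set (Matrix (Fin 2) (Fin 2) F) := (fun q : ↥(glInt 2 F) × Matrix (Fin 2) (Fin 2) F =>
      ((((q.1 : GL (Fin 2) F))⁻¹ : GL (Fin 2) F) : Matrix (Fin 2) (Fin 2) F) * q.2 * ((q.1 : GL (Fin 2) F) : Matrix (Fin 2) (Fin 2) F)) ''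
    (Set.univ ×ˢ tsupport f) with hC'
  have hC'c : IsCompact C' := (isCompact_univ.prod hf.2).image
    (((Units.continuous_coe_inv.comp (continuous_subtype_val.comp continuous_fst)).mul continuous_snd).mul
      (Units.continuous_val.comp (continuous_subtype_val.comp continuous_fst)))
  set T : Set F := (fun M : Matrix (Fin 2) (Fin 2) F => M 0 1) '' C' with hT
  have hTc : IsCompact T := hC'c.image (continuous_id.matrix_elem 0 1)
  have hsupp : Function.support (fun p : ↥(glInt 2 F) × F =>
      f (((p.1 : GL (Fin 2) F) : Matrix (Fin 2) (Fin 2) F) * !![0, p.2; 0, 0] * ((((p.1 : GL (Fin 2) F))⁻¹ : GL (Fin 2) F) : Matrix (Fin 2) (Fin 2) F))) ⊆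
      Set.univ ×ˢ T := by
    intro p hp
    refine Set.mk_mem_prod (Set.mem_univ _) ⟨_, ⟨⟨p.1, _⟩, Set.mk_mem_prod (Set.mem_univ _) (subset_tsupport _ hp), rfl⟩, ?_⟩
    show (((((p.1 : GL (Fin 2) F))⁻¹ : GL (Fin 2) F) : Matrix (Fin 2) (Fin 2) F) *
        (((p.1 : GL (Fin 2) F) : Matrix (Fin 2) (Fin 2) F) * !![0, p.2; 0, 0] * ((((p.1 : GL (Fin 2) F))⁻¹ : GL (Fin 2) F) : Matrix (Fin 2) (Fin 2) F)) *
        ((p.1 : GL (Fin 2) F) : Matrix (Fin 2) (Fin 2) F)) 0 1 = p.2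
    rw [← nilp_eq_inv_conj_conj]
    simp
  have hcs : HasCompactSupport (fun p : ↥(glInt 2 F) × F =>
      f (((p.1 : GL (Fin 2) F) : Matrix (Fin 2) (Fin 2) F) * !![0, p.2; 0, 0] * ((((p.1 : GL (Fin 2) F))⁻¹ : GL (Fin 2) F) : Matrix (Fin 2) (Fin 2) F))) :=
    IsCompact.of_isClosed_subset (isCompact_univ.prod hTc) (isClosed_tsupport _)
      (closure_minimal hsupp (isClosed_univ.prod hTc.isClosed))
  exact hcont.integrable_of_hasCompactSupport hcs
end Integrable

/-! ## §2  The four `J(𝒩)` clauses for `T(f) = ∫_{K×F} f(k (tE₁₂) k⁻¹)` -/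
section Clauses
variable [MeasurableSpace F] [BorelSpace F] [MeasurableSpace (GL (Fin 2) F)] [BorelSpace (GL (Fin 2) F)]
  (κ : Measure ↥(glInt 2 F)) [IsFiniteMeasureOnCompacts κ] (dx : Measure F) [IsFiniteMeasureOnCompacts dx]

/-- **Additivity** of `T` on `C_c^∞(𝔤𝔩₂(F))` (clause (i) of `J(𝒩)`). [cite: HarishChandra1999AdmissibleDistributions, §3 p. 9] -/
theorem nilpotentAverage_add {f₁ f₂ : Matrix (Fin 2) (Fin 2) F → ℂ} (h₁ : IsLocSmooth f₁) (h₂ : IsLocSmooth f₂) :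
    ∫ p : ↥(glInt 2 F) × F, (f₁ + f₂) (((p.1 : GL (Fin 2) F) : Matrix (Fin 2) (Fin 2) F) * !![0, p.2; 0, 0] *
        ((((p.1 : GL (Fin 2) F))⁻¹ : GL (Fin 2) F) : Matrix (Fin 2) (Fin 2) F)) ∂(κ.prod dx) =
      (∫ p : ↥(glInt 2 F) × F, f₁ (((p.1 : GL (Fin 2) F) : Matrix (Fin 2) (Fin 2) F) * !![0, p.2; 0, 0] *
        ((((p.1 : GL (Fin 2) F))⁻¹ : GL (Fin 2) F) : Matrix (Fin 2) (Fin 2) F)) ∂(κ.prod dx)) +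
      ∫ p : ↥(glInt 2 F) × F, f₂ (((p.1 : GL (Fin 2) F) : Matrix (Fin 2) (Fin 2) F) * !![0, p.2; 0, 0] *
        ((((p.1 : GL (Fin 2) F))⁻¹ : GL (Fin 2) F) : Matrix (Fin 2) (Fin 2) F)) ∂(κ.prod dx) := by
  simp only [Pi.add_apply]
  exact integral_add (integrable_comp_conjNilp κ dx h₁) (integrable_comp_conjNilp κ dx h₂)

omit [TopologicalSpace F] [IsNonarchimedeanLocalField F] [BorelSpace F] [BorelSpace (GL (Fin 2) F)]
  [IsFiniteMeasureOnCompacts κ] [IsFiniteMeasureOnCompacts dx] in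
/-- **Homogeneity** of `T` (clause (ii) of `J(𝒩)`). [cite: HarishChandra1999AdmissibleDistributions, §3 p. 9] -/
theorem nilpotentAverage_smul (a : ℂ) (f : Matrix (Fin 2) (Fin 2) F → ℂ) :
    ∫ p : ↥(glInt 2 F) × F, (a • f) (((p.1 : GL (Fin 2) F) : Matrix (Fin 2) (Fin 2) F) * !![0, p.2; 0, 0] *
        ((((p.1 : GL (Fin 2) F))⁻¹ : GL (Fin 2) F) : Matrix (Fin 2) (Fin 2) F)) ∂(κ.prod dx) =
      a * ∫ p : ↥(glInt 2 F) × F, f (((p.1 : GL (Fin 2) F) : Matrix (Fin 2) (Fin 2) F) * !![0, p.2; 0, 0] *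
        ((((p.1 : GL (Fin 2) F))⁻¹ : GL (Fin 2) F) : Matrix (Fin 2) (Fin 2) F)) ∂(κ.prod dx) := by
  simp only [Pi.smul_apply, smul_eq_mul]
  exact integral_const_mul a _

omit [IsNonarchimedeanLocalField F] [BorelSpace F] [BorelSpace (GL (Fin 2) F)] [IsFiniteMeasureOnCompacts κ] [IsFiniteMeasureOnCompacts dx] in
/-- **Support in the nilpotent cone** (clause (iv) of `J(𝒩)`): if `supp f` contains no nilpotent matrix then `T(f) = 0` (every `k (tE₁₂) k⁻¹` is
nilpotent). [cite: HarishChandra1999AdmissibleDistributions, §3 p. 9] -/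
theorem nilpotentAverage_eq_zero_of_forall_not_isNilpotent {f : Matrix (Fin 2) (Fin 2) F → ℂ}
    (hnil : ∀ X ∈ tsupport f, ¬ IsNilpotent X) :
    ∫ p : ↥(glInt 2 F) × F, f (((p.1 : GL (Fin 2) F) : Matrix (Fin 2) (Fin 2) F) * !![0, p.2; 0, 0] *
        ((((p.1 : GL (Fin 2) F))⁻¹ : GL (Fin 2) F) : Matrix (Fin 2) (Fin 2) F)) ∂(κ.prod dx) = 0 := by
  have h0 : ∀ p : ↥(glInt 2 F) × F, f (((p.1 : GL (Fin 2) F) : Matrix (Fin 2) (Fin 2) F) * !![0, p.2; 0, 0] *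
      ((((p.1 : GL (Fin 2) F))⁻¹ : GL (Fin 2) F) : Matrix (Fin 2) (Fin 2) F)) = 0 := fun p =>
    image_eq_zero_of_notMem_tsupport fun h => hnil _ h (isNilpotent_conj_nilp (F := F) p.1 p.2)
  simp only [h0, integral_zero]
end Clauses

/-! ## §2d  `GL₂(F)`-invariance (clause (iii)), from the group-side unipotent average -/
section Invariance
/-- **Units over a compact set of matrices with unit determinant form a compact subset of `GL_n(F)`**: if `D ⊂ M_n(F)` is compact and `det` is a unit on `D`, then
`{g ∈ GL_n(F) : ↑g ∈ D}` is compact (the units topology is the embedding `g ↦ (g, g⁻¹)`, and `M ↦ M⁻¹` is continuous on `D`). [cite: PlatonovRapinchuk1994, §3.3] -/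
theorem isCompact_preimage_val_of_det {n : Type*} [Fintype n] [DecidableEq n] {D : Set (Matrix n n F)} (hD : IsCompact D)
    (hdet : ∀ M ∈ D, IsUnit M.det) :
    IsCompact ((Units.val : GL n F → Matrix n n F) ⁻¹' D) := by
  have hcont : ContinuousOn (fun M : Matrix n n F => (M, MulOpposite.op M⁻¹)) D := by
    intro M hM
    refine (continuousAt_id.prodMk (MulOpposite.continuous_op.continuousAt.comp ?_)).continuousWithinAt
    refine continuousAt_matrix_inv _ ?_
    rw [Ring.inverse_eq_inv']
    exact continuousAt_inv₀ (hdet M hM).ne_zero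
  have himage : (Units.embedProduct (Matrix n n F)) '' ((Units.val : GL n F → Matrix n n F) ⁻¹' D) =
      (fun M : Matrix n n F => (M, MulOpposite.op M⁻¹)) '' D := by
    ext q
    constructor
    · rintro ⟨u, hu, rfl⟩
      exact ⟨(u : Matrix n n F), hu, by rw [Units.embedProduct_apply, Matrix.coe_units_inv]⟩
    · rintro ⟨M, hM, rfl⟩
      have hu : IsUnit M := (Matrix.isUnit_iff_isUnit_det M).2 (hdet M hM)
      refine ⟨hu.unit, by simpa using hM, ?_⟩
      rw [Units.embedProduct_apply, Matrix.coe_units_inv, hu.unit_spec]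
  rw [Units.isEmbedding_embedProduct.isInducing.isCompact_iff, himage]
  exact hD.image_of_continuousOn hcont

variable [SecondCountableTopology F] [MeasurableSpace F] [BorelSpace F]
  [MeasurableSpace (GL (Fin 2) F)] [BorelSpace (GL (Fin 2) F)] [SecondCountableTopology (GL (Fin 2) F)]
  (κ : Measure ↥(glInt 2 F)) [IsHaarMeasure κ] (dx : Measure F) [dx.IsAddHaarMeasure]

set_option maxHeartbeats 1600000 in
/-- **`GL₂(F)`-INVARIANCE of `T`** (clause (iii) of `J(𝒩)`): `T(f ∘ Ad x) = T(f)` for every `x ∈ GL₂(F)` and `f ∈ C_c^∞(𝔤𝔩₂(F))`.  With the `Ad`-invariant clopen cut-off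
`W = {X | det X ∈ 𝔭, tr X ∈ 𝔭} ⊇ 𝒩`, `g ↦ (1_W f)(g − 1)` is locally constant with compact support on `GL₂(F)` (`isCompact_preimage_val_of_det`: `det(1 + X) = 1 + tr X + det X`
is a unit for `X ∈ W`), it reads `f(k (tE₁₂) k⁻¹)` at `g = k n(t) k⁻¹` (`conj_unipotentGL2_sub_one`), and ★ `GL2.unipotentAverage_comp_conj_eq` applies.
[cite: HarishChandra1999AdmissibleDistributions, §3 p. 9, Thm. 4.4 p. 11] [cite: Rogawski1990, §8.1 p. 112] -/
theorem nilpotentAverage_conj {f : Matrix (Fin 2) (Fin 2) F → ℂ} (hf : IsLocSmooth f) (x : GL (Fin 2) F) :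
    ∫ p : ↥(glInt 2 F) × F, f ((x : Matrix (Fin 2) (Fin 2) F) * (((p.1 : GL (Fin 2) F) : Matrix (Fin 2) (Fin 2) F) * !![0, p.2; 0, 0] *
        ((((p.1 : GL (Fin 2) F))⁻¹ : GL (Fin 2) F) : Matrix (Fin 2) (Fin 2) F)) * ((x⁻¹ : GL (Fin 2) F) : Matrix (Fin 2) (Fin 2) F)) ∂(κ.prod dx) =
      ∫ p : ↥(glInt 2 F) × F, f (((p.1 : GL (Fin 2) F) : Matrix (Fin 2) (Fin 2) F) * !![0, p.2; 0, 0] *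
        ((((p.1 : GL (Fin 2) F))⁻¹ : GL (Fin 2) F) : Matrix (Fin 2) (Fin 2) F)) ∂(κ.prod dx) := by
  classical
  haveI : T2Space F := (isLocalField F).toT2Space
  haveI : T2Space (GL (Fin 2) F) := t2Space_generalLinearGroup F 2
  -- the cut-off `W = {det ∈ 𝔭, tr ∈ 𝔭}` (clopen, `Ad`-invariant, contains the nilpotent cone)
  set W : Set (Matrix (Fin 2) (Fin 2) F) := {X | X.det ∈ primePowBall F 1 ∧ X.trace ∈ primePowBall F 1} with hW
  have hWclopen : IsClopen W := by
    have h1 : IsClopen {X : Matrix (Fin 2) (Fin 2) F | X.det ∈ primePowBall F 1} :=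
      ⟨(isClosed_primePowBall 1).preimage (continuous_id.matrix_det), (isOpen_primePowBall 1).preimage (continuous_id.matrix_det)⟩
    have h2 : IsClopen {X : Matrix (Fin 2) (Fin 2) F | X.trace ∈ primePowBall F 1} :=
      ⟨(isClosed_primePowBall 1).preimage (continuous_id.matrix_trace), (isOpen_primePowBall 1).preimage (continuous_id.matrix_trace)⟩
    exact h1.inter h2
  have hWconj : ∀ (y : GL (Fin 2) F) (X : Matrix (Fin 2) (Fin 2) F),
      (y : Matrix (Fin 2) (Fin 2) F) * X * ((y⁻¹ : GL (Fin 2) F) : Matrix (Fin 2) (Fin 2) F) ∈ W ↔ X ∈ W := by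
    intro y X
    simp only [hW, Set.mem_setOf_eq, Matrix.det_units_conj, Matrix.trace_units_conj]
  have hWnil : ∀ (k : GL (Fin 2) F) (t : F),
      (k : Matrix (Fin 2) (Fin 2) F) * !![0, t; 0, 0] * ((k⁻¹ : GL (Fin 2) F) : Matrix (Fin 2) (Fin 2) F) ∈ W := by
    intro k t
    rw [hWconj]
    refine ⟨?_, ?_⟩
    · rw [Matrix.det_fin_two_of]; simpa using zero_mem_primePowBall (F := F) 1
    · rw [Matrix.trace_fin_two_of]; simpa using zero_mem_primePowBall (F := F) 1
  -- the group-side test function `g ↦ (1_W f)(g − 1)`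
  set f₁ : Matrix (Fin 2) (Fin 2) F → ℂ := W.indicator f with hf₁
  have hf₁sm : IsLocSmooth f₁ := IsLocSmooth.indicator hf hWclopen
  set g : GL (Fin 2) F → ℂ := fun u => f₁ ((u : Matrix (Fin 2) (Fin 2) F) - 1) with hg
  have hglc : IsLocallyConstant g := hf₁sm.1.comp_continuous (Units.continuous_val.sub continuous_const)
  have hgcs : HasCompactSupport g := by
    -- `supp g ⊆ {u : ↑u ∈ 1 + (W ∩ tsupport f)}`, compact by `isCompact_preimage_val_of_det`
    set D : Set (Matrix (Fin 2) (Fin 2) F) := (fun X => X + 1) '' (W ∩ tsupport f) with hD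
    have hDc : IsCompact D := (hf.2.inter_left hWclopen.1).image (continuous_id.add continuous_const)
    have hDdet : ∀ M ∈ D, IsUnit M.det := by
      rintro M ⟨X, ⟨hXW, -⟩, rfl⟩
      have hdet : (X + 1).det = 1 + (X.trace + X.det) := by
        rw [Matrix.det_fin_two, Matrix.trace_fin_two, Matrix.det_fin_two]
        simp only [Matrix.add_apply, Matrix.one_apply_eq, Matrix.one_apply_ne (show (0 : Fin 2) ≠ 1 by decide),
          Matrix.one_apply_ne (show (1 : Fin 2) ≠ 0 by decide)]
        ring
      have hsmall : normAbs F (X.trace + X.det) < normAbs F (1 : F) := by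
        rw [map_one]
        have h := add_mem_primePowBall hXW.2 hXW.1
        rw [mem_primePowBall_iff, zpow_one] at h
        exact lt_of_le_of_lt h inv_residueFieldCard_lt_one
      rw [hdet, isUnit_iff_ne_zero]
      intro h0
      have h1 := normAbs_add_eq_of_lt hsmall
      rw [h0, map_zero, map_one] at h1
      exact zero_ne_one h1
    refine IsCompact.of_isClosed_subset (isCompact_preimage_val_of_det hDc hDdet) (isClosed_tsupport _)
      (closure_minimal (fun u hu => ?_) ((hDc.isClosed).preimage Units.continuous_val))
    have hu' : (u : Matrix (Fin 2) (Fin 2) F) - 1 ∈ W ∩ tsupport f := by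
      have hne : f₁ ((u : Matrix (Fin 2) (Fin 2) F) - 1) ≠ 0 := hu
      by_cases hW' : (u : Matrix (Fin 2) (Fin 2) F) - 1 ∈ W
      · exact ⟨hW', subset_tsupport _ (by rwa [hf₁, Set.indicator_of_mem hW'] at hne)⟩
      · exact absurd (by rw [hf₁, Set.indicator_of_notMem hW']) hne
    exact ⟨_, hu', by simp⟩
  -- dictionary: `g(k n(t) k⁻¹) = f(k tE₁₂ k⁻¹)` and `g(x k n(t) k⁻¹ x⁻¹) = f(x (k tE₁₂ k⁻¹) x⁻¹)`
  have hread : ∀ (y : GL (Fin 2) F) (p : ↥(glInt 2 F) × F),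
      g (y * ((p.1 : GL (Fin 2) F) * ((unipotentGL2 p.2 : ↥(upperUnitriangular (Fin 2) F)) : GL (Fin 2) F) * (p.1 : GL (Fin 2) F)⁻¹) * y⁻¹) =
        f ((y : Matrix (Fin 2) (Fin 2) F) * (((p.1 : GL (Fin 2) F) : Matrix (Fin 2) (Fin 2) F) * !![0, p.2; 0, 0] *
          ((((p.1 : GL (Fin 2) F))⁻¹ : GL (Fin 2) F) : Matrix (Fin 2) (Fin 2) F)) * ((y⁻¹ : GL (Fin 2) F) : Matrix (Fin 2) (Fin 2) F)) := by
    intro y p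
    have hyy : (y : Matrix (Fin 2) (Fin 2) F) * ((y⁻¹ : GL (Fin 2) F) : Matrix (Fin 2) (Fin 2) F) = 1 := by
      rw [← Units.val_mul, mul_inv_cancel, Units.val_one]
    have hsub : ((y * ((p.1 : GL (Fin 2) F) * ((unipotentGL2 p.2 : ↥(upperUnitriangular (Fin 2) F)) : GL (Fin 2) F) * (p.1 : GL (Fin 2) F)⁻¹) * y⁻¹ :
        GL (Fin 2) F) : Matrix (Fin 2) (Fin 2) F) - 1 =
        (y : Matrix (Fin 2) (Fin 2) F) * (((p.1 : GL (Fin 2) F) : Matrix (Fin 2) (Fin 2) F) * !![0, p.2; 0, 0] *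
          ((((p.1 : GL (Fin 2) F))⁻¹ : GL (Fin 2) F) : Matrix (Fin 2) (Fin 2) F)) * ((y⁻¹ : GL (Fin 2) F) : Matrix (Fin 2) (Fin 2) F) := by
      rw [← conj_unipotentGL2_sub_one, Units.val_mul, Units.val_mul, Matrix.mul_sub, Matrix.sub_mul, Matrix.mul_one, hyy]
    show f₁ _ = _
    rw [hsub, hf₁, Set.indicator_of_mem ((hWconj y _).2 (hWnil _ _))]
  have h1 : ∀ p : ↥(glInt 2 F) × F,
      g ((p.1 : GL (Fin 2) F) * ((unipotentGL2 p.2 : ↥(upperUnitriangular (Fin 2) F)) : GL (Fin 2) F) * (p.1 : GL (Fin 2) F)⁻¹) =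
        f (((p.1 : GL (Fin 2) F) : Matrix (Fin 2) (Fin 2) F) * !![0, p.2; 0, 0] * ((((p.1 : GL (Fin 2) F))⁻¹ : GL (Fin 2) F) : Matrix (Fin 2) (Fin 2) F)) := by
    intro p
    have h := hread 1 p
    simpa only [one_mul, mul_one, inv_one, Units.val_one, Matrix.one_mul, Matrix.mul_one] using h
  -- the group-side invariance
  have hinv := GL2.unipotentAverage_comp_conj_eq κ dx hglc hgcs x
  simp only [hread, h1] at hinv
  exact hinv
end Invariance

/-! ## §3  `T` is not a multiple of `δ₀` -/
section Nondegenerate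
variable [MeasurableSpace F] [BorelSpace F] [MeasurableSpace (GL (Fin 2) F)] [BorelSpace (GL (Fin 2) F)]
  (κ : Measure ↥(glInt 2 F)) [IsHaarMeasure κ] (dx : Measure F) [dx.IsAddHaarMeasure]

set_option maxHeartbeats 1600000 in
/-- **`T(1_U) ≠ 0` for the compact open box `U = E₁₂ + (𝔭)^{2×2}`, while `0 ∉ U = tsupport 1_U`**: so `T` is not a multiple of `δ₀` (and `J(𝒩)` on `𝔤𝔩₂(F)` has the two
linearly independent elements `δ₀`, `T`).  The preimage of `U` under the orbit map is a non-empty open subset of `GL₂(𝒪) × F` (it contains `(1, 1)`), of positive and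
finite measure. [cite: HarishChandra1999AdmissibleDistributions, Thm. 3.9, Cor. 3.10 p. 10] -/
theorem nilpotentAverage_indicator_ne_zero :
    IsLocSmooth ({X : Matrix (Fin 2) (Fin 2) F | ∀ i j, X i j - (!![0, 1; 0, 0] : Matrix (Fin 2) (Fin 2) F) i j ∈ primePowBall F 1}.indicator fun _ => (1 : ℂ)) ∧
    (0 : Matrix (Fin 2) (Fin 2) F) ∉ tsupport ({X : Matrix (Fin 2) (Fin 2) F | ∀ i j, X i j - (!![0, 1; 0, 0] : Matrix (Fin 2) (Fin 2) F) i j ∈ primePowBall F 1}.indicator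
      fun _ => (1 : ℂ)) ∧
    ∫ p : ↥(glInt 2 F) × F, ({X : Matrix (Fin 2) (Fin 2) F | ∀ i j, X i j - (!![0, 1; 0, 0] : Matrix (Fin 2) (Fin 2) F) i j ∈ primePowBall F 1}.indicator
        fun _ => (1 : ℂ)) (((p.1 : GL (Fin 2) F) : Matrix (Fin 2) (Fin 2) F) * !![0, p.2; 0, 0] *
        ((((p.1 : GL (Fin 2) F))⁻¹ : GL (Fin 2) F) : Matrix (Fin 2) (Fin 2) F)) ∂(κ.prod dx) ≠ 0 := by
  classical
  haveI : T2Space F := (isLocalField F).toT2Space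
  haveI : SecondCountableTopology F := secondCountableTopology_localField F
  haveI : BorelSpace ↥(glInt 2 F) := Subtype.borelSpace _
  haveI : CompactSpace ↥(glInt 2 F) := isCompact_iff_compactSpace.1 (isCompact_glInt 2 F)
  set E : Matrix (Fin 2) (Fin 2) F := !![0, 1; 0, 0] with hE
  set U : Set (Matrix (Fin 2) (Fin 2) F) := {X | ∀ i j, X i j - E i j ∈ primePowBall F 1} with hU
  -- `U` is compact open (closed), contains `E`, misses `0`
  have hUo : IsOpen U := by
    simp only [hU, Set.setOf_forall]
    exact isOpen_iInter_of_finite fun i => isOpen_iInter_of_finite fun j =>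
      (isOpen_primePowBall 1).preimage ((continuous_id.matrix_elem i j).sub continuous_const)
  have hUcl : IsClosed U := by
    simp only [hU, Set.setOf_forall]
    exact isClosed_iInter fun i => isClosed_iInter fun j => (isClosed_primePowBall 1).preimage ((continuous_id.matrix_elem i j).sub continuous_const)
  have hUc : IsCompact U := by
    have hset : U = (fun Y : Matrix (Fin 2) (Fin 2) F => Y + E) '' {Y : Matrix (Fin 2) (Fin 2) F | ∀ i j, Y i j ∈ primePowBall F 1} := by
      ext X
      constructor
      · intro hX
        exact ⟨X - E, fun i j => by simpa [Matrix.sub_apply] using hX i j, sub_add_cancel X E⟩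
      · rintro ⟨Y, hY, rfl⟩
        intro i j
        simpa [Matrix.add_apply] using hY i j
    have hbox : IsCompact {Y : Matrix (Fin 2) (Fin 2) F | ∀ i j, Y i j ∈ primePowBall F 1} := by
      have h2 : IsCompact (Set.univ.pi fun _ : Fin 2 => Set.univ.pi fun _ : Fin 2 => primePowBall F 1 : Set (Fin 2 → Fin 2 → F)) :=
        isCompact_univ_pi fun _ => isCompact_univ_pi fun _ => isCompact_primePowBall 1
      have h3 := h2.image (show Continuous (Matrix.of : (Fin 2 → Fin 2 → F) → Matrix (Fin 2) (Fin 2) F) from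
        continuous_matrix fun i j => (continuous_apply j).comp (continuous_apply i))
      refine (congrArg IsCompact ?_).mp h3
      ext X
      refine ⟨?_, fun hX => ⟨Matrix.of.symm X, Set.mem_univ_pi.2 fun i => Set.mem_univ_pi.2 fun j => hX i j, Matrix.of.apply_symm_apply X⟩⟩
      rintro ⟨x, hx, rfl⟩
      exact fun i j => Set.mem_univ_pi.1 (Set.mem_univ_pi.1 hx i) j
    rw [hset]
    exact hbox.image (continuous_id.add continuous_const)
  have hEU : E ∈ U := fun i j => by simpa using zero_mem_primePowBall (F := F) 1
  have h0U : (0 : Matrix (Fin 2) (Fin 2) F) ∉ U := by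
    intro h
    have h01 := h 0 1
    simp only [hE, Matrix.zero_apply, Matrix.of_apply, Matrix.cons_val', Matrix.cons_val_one, Matrix.cons_val_fin_one,
      Matrix.cons_val_zero, zero_sub, mem_primePowBall_iff, normAbs_neg, map_one, zpow_one] at h01
    exact not_lt.2 h01 inv_residueFieldCard_lt_one
  refine ⟨isLocSmooth_indicator hUo hUcl hUc, fun h => h0U ((tsupport_indicator_subset_of_isClosed _ hUcl) h), ?_⟩
  -- the preimage of `U` under the orbit map: open, contains `(1, 1)`, of finite measure
  set S : Set (↥(glInt 2 F) × F) := (fun p : ↥(glInt 2 F) × F => ((p.1 : GL (Fin 2) F) : Matrix (Fin 2) (Fin 2) F) * !![0, p.2; 0, 0] *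
      ((((p.1 : GL (Fin 2) F))⁻¹ : GL (Fin 2) F) : Matrix (Fin 2) (Fin 2) F)) ⁻¹' U with hS
  have hSo : IsOpen S := hUo.preimage continuous_conjNilp
  have h1S : ((1 : ↥(glInt 2 F)), (1 : F)) ∈ S := by
    show ((((1 : ↥(glInt 2 F)) : GL (Fin 2) F) : Matrix (Fin 2) (Fin 2) F) * !![0, (1 : F); 0, 0] *
      (((((1 : ↥(glInt 2 F)) : GL (Fin 2) F))⁻¹ : GL (Fin 2) F) : Matrix (Fin 2) (Fin 2) F)) ∈ U
    simpa using hEU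
  have hpt : (fun p : ↥(glInt 2 F) × F => U.indicator (fun _ => (1 : ℂ)) (((p.1 : GL (Fin 2) F) : Matrix (Fin 2) (Fin 2) F) * !![0, p.2; 0, 0] *
      ((((p.1 : GL (Fin 2) F))⁻¹ : GL (Fin 2) F) : Matrix (Fin 2) (Fin 2) F))) = S.indicator fun _ => (1 : ℂ) := by
    funext p
    by_cases hp : p ∈ S
    · rw [Set.indicator_of_mem hp, Set.indicator_of_mem (show _ ∈ U from hp)]
    · rw [Set.indicator_of_notMem hp, Set.indicator_of_notMem (show _ ∉ U from hp)]
  have hint := integrable_comp_conjNilp κ dx (isLocSmooth_indicator hUo hUcl hUc)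
  rw [hpt] at hint ⊢
  have hfin : (κ.prod dx) S < ∞ := by
    have h := (integrable_indicator_iff hSo.measurableSet).1 hint
    rcases (integrableOn_const_iff).1 h with h | h
    · simp at h
    · exact h
  have hpos : 0 < (κ.prod dx) S := hSo.measure_pos _ ⟨_, h1S⟩
  rw [integral_indicator_const _ hSo.measurableSet, Complex.real_smul, mul_one, Complex.ofReal_ne_zero, measureReal_def]
  exact (ENNReal.toReal_pos hpos.ne' hfin.ne).ne'
end Nondegenerate

end Summit.HodgeConjecture.HodgeConjecture.Cruxes.H413.K2E3GL2RegularNilpotentOrbitalMeasure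

end
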